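import Literature.NumberTheory.Automorphic.ShimuraCurveRibetTakahashiOptimalProofs
import Literature.NumberTheory.EllipticCurves.NeronIsogenyScaling
import Literature.NumberTheory.EllipticCurves.RationalIsogenyDegrees
import Literature.NumberTheory.EllipticCurves.IsogenyDegreeLatticeIndexProofs
import Literature.NumberTheory.EllipticCurves.SzpiroFreyConductorProofs
import Literature.NumberTheory.EllipticCurves.SzpiroOfAbcProofs
import Literature.NumberTheory.EllipticCurves.DegreeConjectureAbcMurtyProofs
import Literature.NumberTheory.DiophantineGeometry.PastenValuationProductsProofs
import HarnessLib

/-!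
# Pasten's Remark 3.3: bounded Manin constants for the Frey–Hellegouarch curves, and Murty's
# Theorem 1 (abc ⟺ the degree conjecture on the Frey curves) from named facts

Topic `NumberTheory/Automorphic`; a proofs-only companion (theorems only, no new named fact) of
`Literature.NumberTheory.Automorphic.PastenShimura2024_cor_10_2` (H. Pasten, *Shimura curves and
the abc conjecture*, J. Number Theory 254 (2024) = arXiv:1705.09251 [PastenShimura2024],
Cor. 10.2 p. 33 = Thm. 1.3 p. 4: for every finite set of primes `S` there is `𝓜_S` with
`c_f ≤ 𝓜_S` for every optimal elliptic curve over `ℚ` which is semi-stable away from `S`),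
written by the seat of that fact. It proves the one APPLICATION of Cor. 10.2 printed in the paper,
Remark 3.3 (p. 13):

> "Other expositions (such as [SzpiroDisc] or [MurtyBounds]) formulate the degree conjecture as we
> did above in Conjecture 3.2, but at present it is not clear that this version is equivalent to the
> height conjecture. Our bounds for the Manin constant (cf. Corollary 10.2) show that this is indeed
> the case if additive reduction is restricted to a fixed finite set of primes, such as for
> Frey-Hellegouarch elliptic curves. The latter fills a gap in Theorem 1 of [MurtyBounds] (repeated
> elsewhere in the literature) concerning the equivalence of the abc conjecture and the modular
> degree conjecture for Frey-Hellegouarch elliptic curves."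

In the tree, Murty's Theorem 1 is the named fact
`Literature.NumberTheory.EllipticCurves.abcLe_iff_freyDegreeConjecture` (Murty 1999, Thm. 1), and
its assembly `abcLe_iff_freyDegreeConjecture_of` (`DegreeConjectureAbcMurtyProofs.lean`) takes
three inputs: the Hoffstein–Lockhart lower bound (named fact
`murty_petersson_newform_lower_bound`), the Petersson upper bound `(f,f) ≪_η N^{1+η}` (explicit
hypothesis `hUp`), and

* `hM` — *the Frey curves `E_{a,b} : y² = x(x − a)(x + b)` admit modular parametrisation data, at
  the level of their conductor, with UNIFORMLY BOUNDED Manin constants* — "Murty: by recent work of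
  Edixhoven we know that `c` is bounded; for Frey–Hellegouarch curves this is the modularity
  theorem together with Pasten 2024, Thm. 1.3 / Rem. 3.3".

This file PROVES `hM` from four named facts of the tree, all existing
(`PastenShimura2024_cor_10_2.exists_freyCurve_datum_maninConstant_le`, with `M = 163 · 𝓜_{{2}}`;
more generally `PastenShimura2024_cor_10_2.exists_datum_maninConstant_le`: for every finite `S`,
every globally minimal — or merely integral, `…_of_integralModel` — elliptic equation over `ℚ` with
conductor square-free away from `S` has a datum at the level of its conductor with
`|c| ≤ 163 · 𝓜_S`; and `…_of_isSemistable`, the shape consumed by the `abc` routes):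

1. `PastenShimura2024_cor_10_2` at `S = {2}` (Pasten, Cor. 10.2): `|c| ≤ 𝓜` for the datum of
   minimal degree on a globally minimal model at a level `N` square-free away from `2`;
2. `exists_optimal_modularParametrizationData` (the optimal quotient `X₀(N) → A_{1,N}` as a datum:
   the Modularity theorem with Edixhoven's integrality `c_f ∈ ℤ`, Pasten §2 p. 12, §3 p. 13);
3. `Literature.NumberTheory.EllipticCurves.mazurKenku_exists_cyclic_isogeny` (Mazur 1978, Thm. 1;
   Kenku 1982: a rational cyclic isogeny has degree `≤ 163` — Pasten §3 p. 13: "The degree of a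
   minimal isogeny between `A_{1,N}` and `E` is uniformly bounded by `163` thanks to Mazur and
   Kenku");
4. `Literature.NumberTheory.EllipticCurves.integral_neronScaling_of_isGloballyMinimal` (the Néron
   mapping property, Silverman *ATAEC* IV.5.1 with IV.6.1 and Cor. IV.9.1: a rational isogeny
   between globally minimal models pulls the Néron differential back to an INTEGRAL multiple of the
   Néron differential).

Argument (the paragraph of §3 p. 13 around (EqFrey), made quantitative in the Manin constant
rather than in the Faltings height). Let `a, b` be coprime with `ab(a+b) ≠ 0`, `F = freyCurve a b`
and `N = N_F`. The conductor of `F` divides `2⁸ · rad(ab(a+b))` (the tree's discharged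
`conductorNorm_freyCurve_dvd_holds`, Frey 1986; Bombieri–Gubler Ex. 12.5.10), so `N` is
square-free away from `2`. Let `W = C • F` be a global minimal model of `F` (Silverman *AEC*
VIII.8.3, `hasGlobalMinimalModel_rat_holds`); since `F` has integer coefficients, `u(C) ∈ ℤ`
(`exists_int_cast_eq_u_of_isGloballyMinimal_of_smul_baseChange_eq`), so the Néron lattice
`Λ_W = u Λ_F` (`IsNeronLatticeOf.lattice_eq_mulLeft_of_smul`) is CONTAINED in the period lattice
`Λ_F` of the Frey equation. By (2) there are a globally minimal `W₀ ~ W` (a minimal model of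
`A_{1,N}`) and a datum `D₀` on `W₀` at level `N` of minimal degree with the newform `f` of `W`;
by (1), `|c₀| ≤ 𝓜` for `c₀ = D₀.c` (`c₀ Λ_f ⊆ Λ_{W₀}`). By (3) there is a cyclic `ℚ`-isogeny
`ψ : W₀ → W` (between the short models `E_{Λ_{W₀}}`, `E_{Λ_W}`) of degree `d ≤ 163`; its rational
multiplier `q` satisfies `q Λ_{W₀} ⊆ Λ_W` with `[Λ_W : q Λ_{W₀}] = d`
(`degree_eq_natCard_ker_mulQuotientMap_of_baseChange_eq_curve`, Silverman *AEC* VI.4.1 (b)), hence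
also `(d/q) Λ_W ⊆ Λ_{W₀}` (Lagrange on the kernel); by (4), applied in both directions between the
two minimal models, `q ∈ ℤ` and `d/q ∈ ℤ`, so `|q| ≤ d ≤ 163`
(`exists_int_mul_mem_lattice_natAbs_le_163`). Therefore `k = q c₀ ∈ ℤ ∖ {0}` satisfies
`k Λ_f ⊆ q Λ_{W₀} ⊆ Λ_W ⊆ Λ_F` and `|k| ≤ 163 𝓜`, and `(f, Λ_F, k)` is a modular parametrisation
datum of `F` at level `N` (`ModularParametrizationData.exists_of_isNewformOf`: `f` is the newform
of `F ≅ W`, the uniformisation of `F(ℂ)` by `ℂ/Λ_F` and the degree of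
`Γ₀(N)τ ↦ k · 2πi ∫_{i∞}^τ f (mod Λ_F)` are theorems of the tree) with Manin constant `k`.

Consequently (`abcLe_iff_freyDegreeConjecture_of_cor_10_2`) Murty's Theorem 1 holds relative to
`murty_petersson_newform_lower_bound`, the Petersson upper bound `hUp`, and the four named facts
above — Pasten's Remark 3.3 over the tree. Nothing is discharged unconditionally and no statement
of the tree is changed; the hypotheses are named facts of the tree taken verbatim (no new `Prop`
is minted here).

## References

* H. Pasten, *Shimura curves and the abc conjecture*, J. Number Theory 254 (2024) 214–335
  = arXiv:1705.09251: Rem. 3.3 and §3 p. 13; Cor. 10.2 p. 33 (= Thm. 1.3 p. 4). [PastenShimura2024]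
* M. Ram Murty, *Bounds for congruence primes*, Proc. Sympos. Pure Math. 66.1 (1999) 177–192,
  Thm. 1 and §2. [MurtyCongruencePrimes1999]
* B. Mazur, *Rational isogenies of prime degree*, Invent. Math. 44 (1978), Thm. 1. [Mazur1978]
* M. A. Kenku, *On the number of `ℚ`-isomorphism classes of elliptic curves in each
  `ℚ`-isogeny class*, J. Number Theory 15 (1982). [Kenku1982]
* J. H. Silverman, *The Arithmetic of Elliptic Curves*, 2nd ed., GTM 106 (2009): III.1 Table 3.1,
  Thm. VI.4.1, VIII.8.3, IX.6 Example 6.4. [SilvermanAEC2009]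
* J. H. Silverman, *Advanced Topics in the Arithmetic of Elliptic Curves*, GTM 151 (1994): IV.5.1,
  IV.6.1, Cor. IV.9.1. [SilvermanATAEC1994]
* B. Edixhoven, *On the Manin constants of modular elliptic curves* (1991), Prop. 2.
  [EdixhovenManin1991]
* E. Bombieri, W. Gubler, *Heights in Diophantine Geometry*, CUP 2006, Ex. 12.5.10 (the conductor
  of the Frey curve). [BombieriGubler2006]
-/

noncomputable section

open scoped MatrixGroups ModularForm

open CongruenceSubgroup UpperHalfPlane

namespace Literature.NumberTheory.Automorphic

open Literature.NumberTheory.EllipticCurves Literature.NumberTheory.EllipticCurves.ModularForms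
open _root_.WeierstrassCurve UniqueFactorizationMonoid

/-! ### Lagrange on the kernel of `z ↦ q z : ℂ/Λ₀ → ℂ/Λ` -/

/-- **The order of the kernel of `z ↦ qz : ℂ/Λ₀ → ℂ/Λ` kills `q⁻¹Λ/Λ₀`.** For subgroups
`Λ₀, Λ ≤ ℂ`, `q ≠ 0` with `qΛ₀ ⊆ Λ`, and `d = #ker(z ↦ qz)` (`d = 0` if the kernel is infinite),
every `x ∈ Λ` satisfies `d · q⁻¹ x ∈ Λ₀`, i.e. `(d/q) Λ ⊆ Λ₀`: the coset of `q⁻¹x` lies in the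
kernel, whose elements have order dividing `d` (Lagrange). For lattices this is the dual isogeny
relation `φ̂_q ∘ φ_q = [d]` of Silverman, *AEC*, Thm. VI.4.1 with III.6.1 read on `ℂ/Λ`.
[cite: SilvermanAEC2009, Thm. VI.4.1(b) (PDF pp. 152–154)] -/
theorem mul_inv_mul_mem_of_natCard_ker_mulQuotientMap {Λ₀ Λ : AddSubgroup ℂ} {q : ℂ}
    (hq0 : q ≠ 0) {hq : ∀ z ∈ Λ₀, q * z ∈ Λ} {x : ℂ} (hx : x ∈ Λ) :
    (Nat.card (mulQuotientMap Λ₀ Λ q hq).ker : ℂ) * (q⁻¹ * x) ∈ Λ₀ := by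
  -- the coset of `q⁻¹ x` lies in the kernel
  have hmem : ((q⁻¹ * x : ℂ) : ℂ ⧸ Λ₀) ∈ (mulQuotientMap Λ₀ Λ q hq).ker := by
    rw [AddMonoidHom.mem_ker, mulQuotientMap_mk, mul_inv_cancel_left₀ hq0,
      QuotientAddGroup.eq_zero_iff]
    exact hx
  -- Lagrange: `#ker •` kills every element of the kernel
  have hkill : Nat.card (mulQuotientMap Λ₀ Λ q hq).ker • ((q⁻¹ * x : ℂ) : ℂ ⧸ Λ₀) = 0 :=
    addOrderOf_dvd_iff_nsmul_eq_zero.mp (AddSubgroup.addOrderOf_dvd_natCard _ hmem)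
  rw [← QuotientAddGroup.mk_nsmul, QuotientAddGroup.eq_zero_iff, nsmul_eq_mul] at hkill
  exact hkill

/-! ### A bounded integral multiplier between the Néron lattices of isogenous minimal models -/

/-- **Between the Néron lattices of two `ℚ`-isogenous GLOBALLY MINIMAL elliptic curves there is an
integral multiplier `k` with `1 ≤ |k| ≤ 163`.** Let `W₀ ~ W` be `ℚ`-isogenous elliptic curves over
`ℚ`, both given by globally minimal equations, with Néron lattices `Λ₀ = Λ_{W₀}`, `Λ = Λ_W`
(`IsNeronLatticeOf`). Mazur–Kenku (`mazurKenku_exists_cyclic_isogeny`; Mazur 1978, Thm. 1; Kenku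
1982; Silverman *AEC* IX.6 Ex. 6.4) give a cyclic `ℚ`-isogeny `ψ` of degree `d ≤ 163` between the
short models `E_{Λ₀}`, `E_Λ`; its rational multiplier `q` has `qΛ₀ ⊆ Λ`, `[Λ : qΛ₀] = d`
(Silverman *AEC* VI.4.1 (b), the tree's `degree_eq_natCard_ker_mulQuotientMap_of_baseChange_eq_curve`),
so `(d/q)Λ ⊆ Λ₀` too; the Néron mapping property for the two minimal models
(`integral_neronScaling_of_isGloballyMinimal`, Silverman *ATAEC* IV.5.1, IV.6.1, Cor. IV.9.1) makes
`q` and `d/q` integers, whence `|q| ∣ d ≤ 163`, and `k = q` serves. (Pasten 2024, §3 p. 13: "The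
degree of a minimal isogeny between `A_{1,N}` and `E` is uniformly bounded by `163` thanks to Mazur
and Kenku, so Lemma 5 in [Faltings] gives `|h(A_{1,N}) − h(E)| ≤ ½ log 163`" — the same two inputs.)
[cite: PastenShimura2024, §3 p. 13] [cite: SilvermanAEC2009, IX.6 Example 6.4 and Thm. VI.4.1(b)]
[cite: SilvermanATAEC1994, IV.5.1 with IV.6.1 and Cor. IV.9.1] -/
theorem exists_int_mul_mem_lattice_natAbs_le_163 (hMK : mazurKenku_exists_cyclic_isogeny)
    (hNS : integral_neronScaling_of_isGloballyMinimal) {W₀ W : WeierstrassCurve ℚ}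
    [W₀.IsElliptic] [W.IsElliptic] [W₀.IsGloballyMinimal] [W.IsGloballyMinimal]
    (hiso : IsIsogenous W₀ W) {L₀ L : PeriodPair} (hL₀ : IsNeronLatticeOf (W₀.baseChange ℂ) L₀)
    (hL : IsNeronLatticeOf (W.baseChange ℂ) L) :
    ∃ k : ℤ, k ≠ 0 ∧ k.natAbs ≤ 163 ∧ ∀ z ∈ L₀.lattice, (k : ℂ) * z ∈ L.lattice := by
  -- the short models are `E_{Λ₀}`, `E_Λ` after base change, and are `ℚ`-isogenous
  set C₀ : VariableChange ℚ := ⟨1, -W₀.b₂ / 12, -W₀.a₁ / 2, W₀.a₁ * W₀.b₂ / 24 - W₀.a₃ / 2⟩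
    with hC₀
  set C : VariableChange ℚ := ⟨1, -W.b₂ / 12, -W.a₁ / 2, W.a₁ * W.b₂ / 24 - W.a₃ / 2⟩ with hC
  have hE₀ : (C₀ • W₀).baseChange ℂ = L₀.curve := shortModel_baseChange_eq_curve W₀ hL₀
  have hE : (C • W).baseChange ℂ = L.curve := shortModel_baseChange_eq_curve W hL
  have h : IsIsogenous (C₀ • W₀) (C • W) :=
    (isIsogenous_of_smul W₀ C₀).trans' (hiso.trans' (isIsogenous_smul W C))
  -- Mazur–Kenku: a cyclic `ℚ`-isogeny `ψ` of degree `1 ≤ d ≤ 163`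
  obtain ⟨ψ, -, hdeg⟩ := hMK (C₀ • W₀) (C • W) h
  have h163 : ψ.degree ≤ 163 := le_of_mem_kenkuDegrees hdeg
  have hpos : 0 < ψ.degree := pos_of_mem_kenkuDegrees hdeg
  -- its rational multiplier `q`: `qΛ₀ ⊆ Λ`, `#ker(z ↦ qz) = deg ψ`
  obtain ⟨q, hq0, hq, hdegq⟩ :=
    degree_eq_natCard_ker_mulQuotientMap_of_baseChange_eq_curve ψ hE₀ hE
  -- `q ∈ ℤ`: the Néron mapping property between the two minimal models
  obtain ⟨k, hk⟩ := hNS W₀ W L₀ L hL₀ hL q hq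
  -- `(d/q) Λ ⊆ Λ₀` (Lagrange on the kernel), so `d/q ∈ ℤ` as well
  have hqC : (q : ℂ) ≠ 0 := by exact_mod_cast hq0
  have hq' : ∀ z ∈ L.lattice, (((ψ.degree : ℚ) / q : ℚ) : ℂ) * z ∈ L₀.lattice := fun z hz ↦ by
    have hmem := mul_inv_mul_mem_of_natCard_ker_mulQuotientMap (Λ₀ := L₀.lattice.toAddSubgroup)
      (Λ := L.lattice.toAddSubgroup) hqC (hq := hq) (show z ∈ L.lattice.toAddSubgroup from hz)
    rw [← hdegq] at hmem
    have hcast : (((ψ.degree : ℚ) / q : ℚ) : ℂ) * z = (ψ.degree : ℂ) * ((q : ℂ)⁻¹ * z) := by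
      push_cast
      field_simp
    rw [hcast]
    exact hmem
  obtain ⟨k', hk'⟩ := hNS W W₀ L L₀ hL hL₀ _ hq'
  -- `k k' = d`, hence `|k| ∣ d ≤ 163`
  have hkk' : k * k' = ψ.degree := by
    have h1 : (k : ℚ) * k' = ψ.degree := by rw [hk, hk', mul_div_cancel₀ _ hq0]
    exact_mod_cast h1
  have hk0 : k ≠ 0 := by
    rintro rfl
    rw [zero_mul] at hkk'
    exact hpos.ne' (by exact_mod_cast hkk'.symm)
  refine ⟨k, hk0, ?_, fun z hz ↦ ?_⟩
  · have hdvd : k.natAbs ∣ ψ.degree :=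
      ⟨k'.natAbs, by rw [← Int.natAbs_mul, hkk', Int.natAbs_natCast]⟩
    exact (Nat.le_of_dvd hpos hdvd).trans h163
  · have h1 := hq z hz
    rwa [← hk, Rat.cast_intCast] at h1

/-! ### Thm. 1.3 along isogenies: bounded Manin constants for every minimal model of the family -/

/-- **Pasten's Cor. 10.2 transported along isogenies: every GLOBALLY MINIMAL elliptic curve over
`ℚ` whose conductor is square-free away from `S` has a modular parametrisation datum, at the level
of its conductor, with Manin constant bounded by `163 · 𝓜_S`.** Pasten §3 p. 13 passes from the
optimal quotient `A_{1,N}` to an arbitrary `E` of the family by "The degree of a minimal isogeny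
between `A_{1,N}` and `E` is uniformly bounded by `163` thanks to Mazur and Kenku, so Lemma 5 in
[Faltings] gives `|h(A_{1,N}) − h(E)| ≤ ½ log 163`"; the same passage in the Manin constant: by
`exists_optimal_modularParametrizationData` a globally minimal `W` of conductor `N` is isogenous to
a globally minimal `W₀` (a minimal model of `A_{1,N}`) carrying the datum `D₀` of minimal degree
with the newform `f` of `W`, `c₀ Λ_f ⊆ Λ_{W₀}`, and `|c₀| ≤ 𝓜_S` by `PastenShimura2024_cor_10_2`;
an integral multiplier `k₁` with `|k₁| ≤ 163` takes `Λ_{W₀}` into the Néron lattice `Λ_W`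
(`exists_int_mul_mem_lattice_natAbs_le_163`: Mazur–Kenku with the Néron mapping property); so
`k = k₁ c₀` has `k Λ_f ⊆ Λ_W`, and `(f, Λ_W, k)` is a datum of `W` at level `N`
(`ModularParametrizationData.exists_of_isNewformOf`) with `|k| ≤ 163 𝓜_S`.
[cite: PastenShimura2024, §3 p. 13 and Cor. 10.2 p. 33] [cite: SilvermanAEC2009, IX.6 Example 6.4] -/
theorem PastenShimura2024_cor_10_2.exists_datum_maninConstant_le
    (h102 : PastenShimura2024_cor_10_2) (hopt : exists_optimal_modularParametrizationData)
    (hMK : mazurKenku_exists_cyclic_isogeny) (hNS : integral_neronScaling_of_isGloballyMinimal)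
    (S : Finset ℕ) :
    ∃ M : ℕ, ∀ (W : WeierstrassCurve ℚ) [W.IsElliptic] [W.IsGloballyMinimal] (N : ℕ) [NeZero N],
      W.conductorNorm ℤ = N → (∀ p : ℕ, p.Prime → p ∉ S → ¬ p ^ 2 ∣ N) →
        ∃ D : ModularParametrizationData W N, D.maninConstant.natAbs ≤ M := by
  obtain ⟨𝓜, h𝓜⟩ := h102 S
  refine ⟨163 * 𝓜, fun W _ _ N _ hN hsq ↦ ?_⟩
  haveI : (W.baseChange ℂ).IsElliptic := by rw [WeierstrassCurve.baseChange]; infer_instance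
  -- the optimal curve `W₀ ~ W` and its datum `D₀` of minimal degree; Pasten's bound `|c₀| ≤ 𝓜`
  obtain ⟨W₀, hW₀, hW₀min, D₀, hfW, hisoW, hmin⟩ := hopt N W hN
  haveI := hW₀
  haveI := hW₀min
  have hc𝓜 : |D₀.maninConstant| ≤ (𝓜 : ℤ) := h𝓜 N W₀ D₀ hsq hmin
  have hc₀ : D₀.c.natAbs ≤ 𝓜 := by
    have h1 : ((D₀.c.natAbs : ℕ) : ℤ) ≤ 𝓜 := by rw [Int.natCast_natAbs]; exact hc𝓜
    exact_mod_cast h1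
  -- a bounded integral multiplier `Λ_{W₀} → Λ_W` (Mazur–Kenku with the Néron mapping property)
  obtain ⟨LW, hLW⟩ := exists_isNeronLatticeOf_holds (W.baseChange ℂ)
  obtain ⟨k, hk0, hk163, hk⟩ := exists_int_mul_mem_lattice_natAbs_le_163 hMK hNS
    hisoW.symm_of_charZero D₀.isNeronLattice hLW
  -- the multiplier `k c₀` takes `Λ_f` into `Λ_W`; the datum `(f, Λ_W, k c₀)`
  have hm0 : k * D₀.c ≠ 0 := mul_ne_zero hk0 D₀.maninConstant_ne_zero_holds
  have hle : ∀ z ∈ periodLattice D₀.f, ((k * D₀.c : ℤ) : ℂ) * z ∈ LW.lattice := fun z hz ↦ by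
    have h2 := hk _ (D₀.smul_periodLattice_le z hz)
    rwa [← mul_assoc, ← Int.cast_mul] at h2
  obtain ⟨D, -, -, hDc⟩ := ModularParametrizationData.exists_of_isNewformOf hfW hLW hm0 hle
  refine ⟨D, ?_⟩
  show D.c.natAbs ≤ 163 * 𝓜
  rw [hDc, Int.natAbs_mul]
  exact Nat.mul_le_mul hk163 hc₀

/-- **The same for an arbitrary Weierstrass equation with INTEGER coefficients** (not necessarily
minimal), with the same bound: if `F = W₁ ⊗ ℚ` for an equation `W₁` over `ℤ` and `W = C • F` is a
global minimal model (Silverman *AEC* VIII.8.3, `hasGlobalMinimalModel_rat_holds`), then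
`u(C) ∈ ℤ` (`exists_int_cast_eq_u_of_isGloballyMinimal_of_smul_baseChange_eq`: `Δ(F) = u¹² Δ(W)`
with `W` minimal at every prime), so the Néron lattice `Λ_W = u Λ_F`
(`IsNeronLatticeOf.lattice_eq_mulLeft_of_smul`, *AEC* III.1 Table 3.1) is contained in the period
lattice `Λ_F` of the invariant differential of `F`, and the multiplier `k` of a datum of `W`
(`exists_datum_maninConstant_le`) serves for `F`: `k Λ_f ⊆ Λ_W ⊆ Λ_F`. (For a non-integral
equation the period lattice shrinks and no such bound can hold.)
[cite: PastenShimura2024, §3 p. 13 and Cor. 10.2 p. 33] [cite: SilvermanAEC2009, III.1 Table 3.1 and VIII.8.3] -/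
theorem PastenShimura2024_cor_10_2.exists_datum_maninConstant_le_of_integralModel
    (h102 : PastenShimura2024_cor_10_2) (hopt : exists_optimal_modularParametrizationData)
    (hMK : mazurKenku_exists_cyclic_isogeny) (hNS : integral_neronScaling_of_isGloballyMinimal)
    (S : Finset ℕ) :
    ∃ M : ℕ, ∀ (W₁ : WeierstrassCurve ℤ) [(W₁.baseChange ℚ).IsElliptic] (N : ℕ) [NeZero N],
      (W₁.baseChange ℚ).conductorNorm ℤ = N → (∀ p : ℕ, p.Prime → p ∉ S → ¬ p ^ 2 ∣ N) →
        ∃ D : ModularParametrizationData (W₁.baseChange ℚ) N, D.maninConstant.natAbs ≤ M := by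
  obtain ⟨M, hM⟩ := PastenShimura2024_cor_10_2.exists_datum_maninConstant_le h102 hopt hMK hNS S
  refine ⟨M, fun W₁ _ N _ hN hsq ↦ ?_⟩
  haveI : ((W₁.baseChange ℚ).baseChange ℂ).IsElliptic := by
    rw [WeierstrassCurve.baseChange]; infer_instance
  -- a global minimal model `W = C • F`, with `u(C) ∈ ℤ`
  obtain ⟨C, hCmin⟩ := hasGlobalMinimalModel_rat_holds (W₁.baseChange ℚ)
  haveI := hCmin
  obtain ⟨u, hu⟩ := exists_int_cast_eq_u_of_isGloballyMinimal_of_smul_baseChange_eq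
    (C • W₁.baseChange ℚ) W₁ C rfl
  have hNW : (C • W₁.baseChange ℚ).conductorNorm ℤ = N := by rw [conductorNorm_smul_rat, hN]
  -- a datum of `W` with `|c| ≤ M`
  obtain ⟨DW, hDW⟩ := hM (C • W₁.baseChange ℚ) N hNW hsq
  -- `Λ_W = u Λ_F ⊆ Λ_F`
  obtain ⟨LF, hLF⟩ := exists_isNeronLatticeOf_holds ((W₁.baseChange ℚ).baseChange ℂ)
  have huC : ((C.u : ℚ) : ℂ) ≠ 0 := by exact_mod_cast C.u.ne_zero
  have huu : (u : ℂ) = ((C.u : ℚ) : ℂ) := by rw [← Rat.cast_intCast, hu]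
  have hWF : ∀ x ∈ DW.L.lattice, x ∈ LF.lattice := fun x hx ↦ by
    rw [IsNeronLatticeOf.lattice_eq_mulLeft_of_smul C hLF DW.isNeronLattice,
      PeriodPair.mem_mulLeft_lattice] at hx
    have hx' : x = u • (((C.u : ℚ) : ℂ)⁻¹ * x) := by
      rw [zsmul_eq_mul, huu, ← mul_assoc, mul_inv_cancel₀ huC, one_mul]
    rw [hx']
    exact LF.lattice.smul_mem u hx
  -- the datum `(f, Λ_F, c)` of `F`
  have hle : ∀ z ∈ periodLattice DW.f, (DW.c : ℂ) * z ∈ LF.lattice := fun z hz ↦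
    hWF _ (DW.smul_periodLattice_le z hz)
  have hfF : IsNewformOf (W₁.baseChange ℚ) DW.f :=
    DW.isNewformOf.of_isIsogenous (isIsogenous_smul (W₁.baseChange ℚ) C)
  obtain ⟨D, -, -, hDc⟩ :=
    ModularParametrizationData.exists_of_isNewformOf hfF hLF DW.maninConstant_ne_zero_holds hle
  refine ⟨D, ?_⟩
  show D.c.natAbs ≤ M
  rw [hDc]
  exact hDW

/-- **The semistable case** (the hypothesis `hM` of the `abc` routes' `stub_ofAbc` /
`semistableDegreeConjecture_of_abc_of_boundedManin`, there obtained from Česnavičius's `c = ±1`):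
every globally minimal SEMISTABLE elliptic curve over `ℚ` has a datum at the level of its
conductor with Manin constant bounded by an absolute `M` — `exists_datum_maninConstant_le` at
`S = ∅`, a semistable curve having square-free conductor
(`WeierstrassCurve.isSemistable_iff_squarefree_conductorNorm`, Silverman *ATAEC* IV.10.2).
[cite: PastenShimura2024, §3 p. 13 and Cor. 10.2 p. 33] -/
theorem PastenShimura2024_cor_10_2.exists_datum_maninConstant_le_of_isSemistable
    (h102 : PastenShimura2024_cor_10_2) (hopt : exists_optimal_modularParametrizationData)
    (hMK : mazurKenku_exists_cyclic_isogeny) (hNS : integral_neronScaling_of_isGloballyMinimal) :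
    ∃ M : ℕ, ∀ (W : WeierstrassCurve ℚ) [W.IsElliptic] [W.IsGloballyMinimal]
      [NeZero (W.conductorNorm ℤ)], W.IsSemistable ℤ →
        ∃ D : ModularParametrizationData W (W.conductorNorm ℤ), D.maninConstant.natAbs ≤ M := by
  obtain ⟨M, hM⟩ := PastenShimura2024_cor_10_2.exists_datum_maninConstant_le h102 hopt hMK hNS ∅
  refine ⟨M, fun W _ _ _ hss ↦ hM W (W.conductorNorm ℤ) rfl fun p hp _ ↦ ?_⟩
  rw [sq]
  exact Nat.squarefree_iff_prime_squarefree.mp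
    ((W.isSemistable_iff_squarefree_conductorNorm).mp hss) p hp

/-! ### Pasten's Remark 3.3: the Frey curves have data with uniformly bounded Manin constants -/

/-- **Pasten 2024, Remark 3.3 (p. 13) with Cor. 10.2: the Frey–Hellegouarch curves admit modular
parametrisation data with UNIFORMLY BOUNDED Manin constants** — the input `hM` of Murty's
Theorem 1 (`abcLe_iff_freyDegreeConjecture_of`: "by recent work of Edixhoven we know that `c` is
bounded"; Pasten: "Our bounds for the Manin constant (cf. Corollary 10.2) show that this is indeed
the case if additive reduction is restricted to a fixed finite set of primes, such as for
Frey-Hellegouarch elliptic curves. The latter fills a gap in Theorem 1 of [MurtyBounds]"). From the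
named facts `PastenShimura2024_cor_10_2` (at `S = {2}`), `exists_optimal_modularParametrizationData`
(modularity with `c_f ∈ ℤ`), `mazurKenku_exists_cyclic_isogeny` and
`integral_neronScaling_of_isGloballyMinimal`, with the bound `M = 163 · 𝓜_{{2}}`:
`freyCurve a b = freyIntModel a b ⊗ ℚ` is an equation over `ℤ` (`baseChange_freyIntModel`) whose
conductor divides `2⁸ · rad(ab(a+b))` (`conductorNorm_freyCurve_dvd_holds`, Frey 1986;
Bombieri–Gubler Ex. 12.5.10), hence is square-free away from `2`, and
`exists_datum_maninConstant_le_of_integralModel` applies.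
[cite: PastenShimura2024, Rem. 3.3 p. 13 and Cor. 10.2 p. 33] [cite: MurtyCongruencePrimes1999, §2]
[cite: BombieriGubler2006, Ex. 12.5.10] -/
theorem PastenShimura2024_cor_10_2.exists_freyCurve_datum_maninConstant_le
    (h102 : PastenShimura2024_cor_10_2) (hopt : exists_optimal_modularParametrizationData)
    (hMK : mazurKenku_exists_cyclic_isogeny) (hNS : integral_neronScaling_of_isGloballyMinimal) :
    ∃ M : ℕ, ∀ a b : ℤ, IsCoprime a b → a * b * (a + b) ≠ 0 →
      ∀ (N : ℕ) [NeZero N], (freyCurve a b).conductorNorm ℤ = N →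
        ∃ D : ModularParametrizationData (freyCurve a b) N, D.maninConstant.natAbs ≤ M := by
  obtain ⟨M, hM⟩ :=
    PastenShimura2024_cor_10_2.exists_datum_maninConstant_le_of_integralModel h102 hopt hMK hNS {2}
  refine ⟨M, fun a b hab h0 N _ hN ↦ ?_⟩
  -- `N` is square-free away from `2`
  have hsq : ∀ p : ℕ, p.Prime → p ∉ ({2} : Finset ℕ) → ¬ p ^ 2 ∣ N := by
    intro p hp hp2 hdvd
    rw [Finset.mem_singleton] at hp2
    have hN' : N ∣ 2 ^ 8 * (radical (a * b * (a + b))).natAbs :=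
      hN ▸ conductorNorm_freyCurve_dvd_holds a b hab h0
    have hcop : (p ^ 2).Coprime (2 ^ 8) :=
      Nat.Coprime.pow 2 8 ((Nat.coprime_primes hp Nat.prime_two).mpr hp2)
    have h3 : p ^ 2 ∣ (radical (a * b * (a + b))).natAbs :=
      hcop.dvd_of_dvd_mul_left (hdvd.trans hN')
    have hsf : Squarefree (radical (a * b * (a + b))).natAbs :=
      Int.squarefree_natAbs.mpr squarefree_radical
    exact hp.ne_one (Nat.isUnit_iff.mp (hsf p (by rw [← sq]; exact h3)))
  -- the Frey equation has integer coefficients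
  haveI := isElliptic_freyIntModel h0
  rw [← baseChange_freyIntModel] at hN ⊢
  exact hM (freyIntModel a b) N hN hsq

/-! ### Murty's Theorem 1 relative to named facts -/

/-- **Murty's Theorem 1 (abc ⟺ the degree conjecture on the Frey curves) with Pasten's complement,
relative to the named facts of the tree.** The named fact `abcLe_iff_freyDegreeConjecture` (Murty
1999, Thm. 1) follows from (i) the Hoffstein–Lockhart lower bound
(`murty_petersson_newform_lower_bound`), (ii) the Petersson upper bound `(f,f) ≪_t N^{1+t}` for every `t > 0`
(`hUp`, as in `abcLe_iff_freyDegreeConjecture_of`), and — replacing the bounded-Manin-constant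
hypothesis `hM` of `abcLe_iff_freyDegreeConjecture_of` — (iii) Pasten's Cor. 10.2
(`PastenShimura2024_cor_10_2`), the optimal-quotient datum (`exists_optimal_modularParametrizationData`),
Mazur–Kenku (`mazurKenku_exists_cyclic_isogeny`) and the Néron mapping property
(`integral_neronScaling_of_isGloballyMinimal`), through
`PastenShimura2024_cor_10_2.exists_freyCurve_datum_maninConstant_le`. This is Pasten's Remark 3.3:
Cor. 10.2 "fills a gap in Theorem 1 of [MurtyBounds] … concerning the equivalence of the abc
conjecture and the modular degree conjecture for Frey-Hellegouarch elliptic curves".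
[cite: PastenShimura2024, Rem. 3.3 p. 13] [cite: MurtyCongruencePrimes1999, Thm. 1 and §2] -/
theorem abcLe_iff_freyDegreeConjecture_of_cor_10_2 (hP : murty_petersson_newform_lower_bound)
    (hUp : ∀ t : ℝ, 0 < t → ∃ C₂ : ℝ, ∀ (N : ℕ) [NeZero N] (W : WeierstrassCurve ℚ) [W.IsElliptic]
      (f : CuspForm (Gamma0 N) 2), IsNewformOf W f →
        (peterssonProduct (Gamma0 N) 2 f f).re ≤ C₂ * (N : ℝ) ^ (1 + t))
    (h102 : PastenShimura2024_cor_10_2) (hopt : exists_optimal_modularParametrizationData)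
    (hMK : mazurKenku_exists_cyclic_isogeny) (hNS : integral_neronScaling_of_isGloballyMinimal) :
    abcLe_iff_freyDegreeConjecture :=
  abcLe_iff_freyDegreeConjecture_of hP hUp
    (PastenShimura2024_cor_10_2.exists_freyCurve_datum_maninConstant_le h102 hopt hMK hNS)

end Literature.NumberTheory.Automorphic

end
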